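import Mathlib.Analysis.SpecialFunctions.Gamma.Beta
import Mathlib.Analysis.SpecialFunctions.Trigonometric.Basic
import Literature.Analysis.SpecialFunctions.LemniscateConstant
import HarnessLib

/-!
# Beta values at quarters

Closed forms for the three canonical transcendental Beta values `B(a,b) = Γ(a)Γ(b)/Γ(a+b)`
of the level-4 rung (parameters in `¼ℤ`):

* `B(1/4, 1/2) = Γ(1/4)² / √(2π)`,
* `B(3/4, 1/2) = 4π√(2π) / Γ(1/4)²`,
* `B(1/2, 1/2) = π`.

All three follow from `Γ(1/2) = √π`, Euler's reflection formula
`Γ(1/4)Γ(3/4) = π / sin(π/4) = √2·π`, `Γ(1) = 1` and the functional equation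
`Γ(5/4) = (1/4)·Γ(1/4)`. The first value is the tree's
`Literature.Analysis.SpecialFunctions.Gamma_quarter_mul_Gamma_half_div_Gamma_three_quarters`.
-/

open Literature.Analysis.SpecialFunctions (Gamma_quarter_mul_Gamma_half_div_Gamma_three_quarters)

namespace Summit.KontsevichZagierPeriods.FermatIsogeny.BetaLinearSector.Quarters

/-- The three canonical Beta values at quarters in closed form:
`B(1/4,1/2) = Γ(1/4)²/√(2π)`, `B(3/4,1/2) = 4π√(2π)/Γ(1/4)²`, `B(1/2,1/2) = π`
(`Γ(1/2) = √π`, Euler reflection `Γ(1/4)Γ(3/4) = √2·π`, `Γ(1) = 1`, `Γ(5/4) = Γ(1/4)/4`).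
[cite: AndrewsAskeyRoy1999, Thm 1.1.4] -/
theorem stub_betaValuesQuarter :
    Real.Gamma (1/4) * Real.Gamma (1/2) / Real.Gamma (1/4 + 1/2) =
        Real.Gamma (1/4) ^ 2 / Real.sqrt (2 * Real.pi) ∧
      Real.Gamma (3/4) * Real.Gamma (1/2) / Real.Gamma (3/4 + 1/2) =
        4 * Real.pi * Real.sqrt (2 * Real.pi) / Real.Gamma (1/4) ^ 2 ∧
      Real.Gamma (1/2) * Real.Gamma (1/2) / Real.Gamma (1/2 + 1/2) = Real.pi := by
  refine ⟨?_, ?_, ?_⟩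
  · -- B(1/4,1/2) = Γ(1/4)Γ(1/2)/Γ(3/4): the tree's lemniscatic value
    rw [show (1 / 4 : ℝ) + 1 / 2 = 3 / 4 by norm_num]
    exact Gamma_quarter_mul_Gamma_half_div_Gamma_three_quarters
  · -- B(3/4,1/2) = Γ(3/4)Γ(1/2)/Γ(5/4), Γ(5/4) = Γ(1/4)/4, Γ(3/4) = √2·π/Γ(1/4)
    have h14 : Real.Gamma (1 / 4) ≠ 0 := (Real.Gamma_pos_of_pos (by norm_num)).ne'
    have hs2 : Real.sqrt 2 ≠ 0 := by positivity
    have hsπ : Real.sqrt Real.pi ≠ 0 := by positivity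
    have h22 : Real.sqrt 2 ^ 2 = 2 := Real.sq_sqrt (by norm_num : (0 : ℝ) ≤ 2)
    -- Euler reflection at `s = 1/4`: Γ(1/4)Γ(3/4) = π / sin(π/4) = π / (√2/2)
    have hrefl := Real.Gamma_mul_Gamma_one_sub (1 / 4 : ℝ)
    rw [show (1 : ℝ) - 1 / 4 = 3 / 4 by norm_num, show Real.pi * (1 / 4 : ℝ) = Real.pi / 4 by ring,
      Real.sin_pi_div_four] at hrefl
    have key : Real.pi / (Real.sqrt 2 / 2) = Real.sqrt 2 * Real.pi := by
      rw [eq_comm, eq_div_iff (by positivity)]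
      linear_combination (Real.pi / 2) * h22
    have hG34 : Real.Gamma (3 / 4) = Real.sqrt 2 * Real.pi / Real.Gamma (1 / 4) := by
      rw [eq_div_iff h14, ← key, ← hrefl]
      exact mul_comm _ _
    rw [show (3 / 4 : ℝ) + 1 / 2 = 1 / 4 + 1 by norm_num,
      Real.Gamma_add_one (by norm_num : (1 / 4 : ℝ) ≠ 0), hG34, Real.Gamma_one_half_eq,
      Real.sqrt_mul' 2 Real.pi_pos.le]
    field_simp
  · -- B(1/2,1/2) = Γ(1/2)²/Γ(1) = √π·√π = π
    rw [show (1 / 2 : ℝ) + 1 / 2 = 1 by norm_num, Real.Gamma_one, div_one, Real.Gamma_one_half_eq]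
    exact Real.mul_self_sqrt Real.pi_pos.le

end Summit.KontsevichZagierPeriods.FermatIsogeny.BetaLinearSector.Quarters
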